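import Literature.NumberTheory.GaloisRepresentations.LocalGaloisGroupFrobeniusProofs
import Literature.NumberTheory.GaloisRepresentations.LocalGaloisGroupProofs
import Mathlib.LinearAlgebra.Matrix.Charpoly.Coeff
import HarnessLib

/-!
# Inertia traces from traces in non-zero Frobenius degree

Helper file for the crux `GaloisRepOfRegularAlgebraic` (stmt-Langlands-10785), line `Sketch`,
stub `stub_inertiaTraces` (S6).  Let `F` be a non-archimedean local field, `ρ : Gal(F̄/F) → GLₙ(k)`
a homomorphism and `β` a multiset of `n` elements of `k` such that `tr ρ(σ) = ∑_{b ∈ β} b ^ d` for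
every `σ` of NON-ZERO Frobenius degree `d` (`IsFrobPow σ d`).  Then the same identity holds in
degree `0`, i.e. `tr ρ(σ) = n` on the inertia group: pick an arithmetic Frobenius `φ`
(`exists_isFrobPow_holds`), put `A = ρ(σ)`, `P = ρ(φ)`; then `σ φ^m` and `φ^m` both have degree
`m`, so `tr(A P^m) = tr(P^m)` for all `m ≥ 1`, and reading the Cayley–Hamilton relation
`∑ cᵢ Pⁱ = 0` (with `c₀ = ± det P ≠ 0`) backwards after multiplying by `A` and taking traces
gives `c₀ (tr A - tr 1) = 0`.  Mathlib plus the accepted `LocalGaloisGroup` API only.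
-/

noncomputable section

set_option linter.dupNamespace false -- project-wide option (lakefile weak.linter.dupNamespace); `Summit.Langlands.Langlands` is the mandated namespace

open scoped MatrixGroups
open Field Literature.NumberTheory.GaloisRepresentations

namespace Summit.Langlands.Langlands.Theorems.GaloisRepOfRegularAlgebraic

/-- **Cayley–Hamilton read backwards.**  If `P` is a square matrix over a field with
`det P ≠ 0` and `A` is a square matrix with `tr(A P^m) = tr(P^m)` for all `m ≥ 1`, then
`tr A = tr 1` (the dimension): multiply `χ_P(P) = ∑ cᵢ Pⁱ = 0` by `A`, take traces and subtract
the trace of `χ_P(P) = 0`; all terms with `i ≥ 1` cancel and `c₀ = ± det P ≠ 0`. [folklore] -/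
private theorem trace_eq_card_of_trace_mul_pow_eq {ι : Type} [Fintype ι] [DecidableEq ι]
    {k : Type} [Field k] (A P : Matrix ι ι k) (hP : P.det ≠ 0)
    (h : ∀ m : ℕ, m ≠ 0 → (A * P ^ m).trace = (P ^ m).trace) :
    A.trace = Fintype.card ι := by
  -- Cayley–Hamilton as an explicit sum
  have hCH : ∑ i ∈ Finset.range (P.charpoly.natDegree + 1), P.charpoly.coeff i • P ^ i = 0 := by
    rw [← Polynomial.aeval_eq_sum_range]
    exact Matrix.aeval_self_charpoly P
  -- multiply by `A`, take traces, subtract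
  have hA : ∑ i ∈ Finset.range (P.charpoly.natDegree + 1),
      P.charpoly.coeff i * (A * P ^ i).trace = 0 := by
    have := congrArg (fun M : Matrix ι ι k => (A * M).trace) hCH
    simpa only [Finset.mul_sum, Matrix.mul_smul, Matrix.trace_sum, Matrix.trace_smul,
      smul_eq_mul, Matrix.mul_zero, Matrix.trace_zero] using this
  have hI : ∑ i ∈ Finset.range (P.charpoly.natDegree + 1),
      P.charpoly.coeff i * (P ^ i).trace = 0 := by
    have := congrArg (fun M : Matrix ι ι k => M.trace) hCH
    simpa only [Matrix.trace_sum, Matrix.trace_smul, smul_eq_mul, Matrix.trace_zero] using this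
  have hdiff : ∑ i ∈ Finset.range (P.charpoly.natDegree + 1),
      P.charpoly.coeff i * ((A * P ^ i).trace - (P ^ i).trace) = 0 := by
    simp_rw [mul_sub, Finset.sum_sub_distrib, hA, hI, sub_zero]
  rw [Finset.sum_eq_single 0 ?_ ?_] at hdiff
  · have hc0 : P.charpoly.coeff 0 ≠ 0 := by
      intro h0
      apply hP
      rw [Matrix.det_eq_sign_charpoly_coeff, h0, mul_zero]
    have h0 := (mul_eq_zero.mp hdiff).resolve_left hc0
    rwa [pow_zero, Matrix.mul_one, Matrix.trace_one, sub_eq_zero] at h0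
  · intro i _ hi
    rw [h i hi, sub_self, mul_zero]
  · intro h0
    exact absurd (Finset.mem_range.mpr (Nat.succ_pos _)) h0

/-- **Inertia traces from non-zero-degree traces (S6 of line `Sketch`).**  If
`tr ρ(σ) = ∑_{b ∈ β} b ^ d` for every `σ ∈ Gal(F̄/F)` of non-zero Frobenius degree `d`, with
`card β = n`, then the identity holds for every Frobenius degree `d`, including `d = 0`
(inertia), where it reads `tr ρ(σ) = n`: with `φ` an arithmetic Frobenius, `σ φ^m` and `φ^m`
have degree `m ≥ 1`, so `tr(ρ(σ) ρ(φ)^m) = tr(ρ(φ)^m)`, and the Cayley–Hamilton relation for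
`ρ(φ)` (constant term `± det ρ(φ) ≠ 0`) read backwards gives `tr ρ(σ) = tr 1 = n`. [folklore] -/
theorem stub_inertiaTraces :
    ∀ {F : Type} [Field F] [ValuativeRel F] [TopologicalSpace F] [IsNonarchimedeanLocalField F]
      {k : Type} [Field k] {n : ℕ} (ρ : absoluteGaloisGroup F →* GL (Fin n) k) (β : Multiset k),
      Multiset.card β = n →
      (∀ (σ : absoluteGaloisGroup F) (d : ℤ), d ≠ 0 → IsFrobPow σ d →
        ((ρ σ : GL (Fin n) k) : Matrix (Fin n) (Fin n) k).trace = (β.map fun b => b ^ d).sum) →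
      ∀ (σ : absoluteGaloisGroup F) (d : ℤ), IsFrobPow σ d →
        ((ρ σ : GL (Fin n) k) : Matrix (Fin n) (Fin n) k).trace = (β.map fun b => b ^ d).sum := by
  intro F _ _ _ _ k _ n ρ β hβ htr σ d hσ
  by_cases hd : d = 0
  swap
  · exact htr σ d hd hσ
  subst hd
  -- the right-hand side is `card β = n`
  have hrhs : (β.map fun b => b ^ (0 : ℤ)).sum = (n : k) := by
    simp only [zpow_zero, Multiset.map_const', Multiset.sum_replicate, nsmul_eq_mul, mul_one, hβ]
  rw [hrhs]
  -- an arithmetic Frobenius `φ`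
  obtain ⟨φ, hφ⟩ := exists_isFrobPow_holds F 1
  have key : ∀ m : ℕ, m ≠ 0 →
      (((ρ σ : GL (Fin n) k) : Matrix (Fin n) (Fin n) k) *
          ((ρ φ : GL (Fin n) k) : Matrix (Fin n) (Fin n) k) ^ m).trace
        = (((ρ φ : GL (Fin n) k) : Matrix (Fin n) (Fin n) k) ^ m).trace := by
    intro m hm
    have hm' : (m : ℤ) ≠ 0 := by exact_mod_cast hm
    have hφm : IsFrobPow (φ ^ m) (m : ℤ) := by simpa using hφ.pow m
    have hσφm : IsFrobPow (σ * φ ^ m) (m : ℤ) := by simpa using IsFrobPow.mul_holds hσ hφm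
    have e1 := htr _ _ hm' hσφm
    have e2 := htr _ _ hm' hφm
    rw [map_mul, map_pow, Units.val_mul, Units.val_pow_eq_pow_val] at e1
    rw [map_pow, Units.val_pow_eq_pow_val] at e2
    rw [e1, e2]
  rw [trace_eq_card_of_trace_mul_pow_eq _ _ (Matrix.GeneralLinearGroup.det_ne_zero (ρ φ)) key,
    Fintype.card_fin]

end Summit.Langlands.Langlands.Theorems.GaloisRepOfRegularAlgebraic

end
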